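import Summits.ValiantsHypothesis.ValiantsHypothesis.Theorems.LangWeilTransferLangWeilBound
import Summits.ValiantsHypothesis.ValiantsHypothesis.Theorems.LangWeilTransferGoodReductionAbsIrreducible
import Summits.ValiantsHypothesis.ValiantsHypothesis.Theorems.LangWeilTransferTransferGlueAlgebra
import Summits.ValiantsHypothesis.ValiantsHypothesis.Theorems.LangWeilTransferTransferGluePrimes
import Summits.ValiantsHypothesis.ValiantsHypothesis.Theorems.LangWeilTransferTransferGlue

/-!
# LangWeilTransfer, crux `TameTransfer` (stmt-ValiantsHypothesis-6373) — the unconditional core for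
# one geometric component: a small prime with an `𝔽_p`-point on an absolutely irreducible integer
# hypersurface, avoiding a second hypersurface

Route `LangWeilTransfer` of `ValiantsHypothesis`. Theorem T (`TameTransfer`) is, after
`transferGlue_proof`, the composite `TameResolution → GoodReduction → LangWeilBound → prime picking`.
For a tame component that is an absolutely irreducible HYPERSURFACE `Q ∈ ℤ[X_0..X_r]` (the `B = 1`
output shape of `TameResolution`: integer leading `X_0`-coefficient `cQ`, positive `X_0`-degree, a
nonzero `ρ ∈ ℤ[X_1..X_r]` to be avoided) everything downstream of `TameResolution` is now a theorem of
the tree, and this file assembles it UNCONDITIONALLY (`exists_small_prime_point`): there is a prime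
`p` with `2^T < p ≤ 2^{β^8}`, `β = T + r + deg Q + deg ρ + log₂ wt Q + log₂ wt ρ + 2`, and a point
`x ∈ 𝔽_p^{r+1}` with `Q(x) = 0 ≠ ρ(x_1..x_r)` — from `goodReduction_of_isAbsIrreducible`'s modulus
(Kaltofen's Noether forms), `exists_prime_gt_notMem_le` (Chebyshev), `not_dvd_of_dvd_map` and
`langWeilBound_proof` (Cafure–Matera). Effective Lang–Weil + Noether–Ostrowski for integer
hypersurfaces in one statement; no GRH, no heights. Honest framing: bookkeeping inside a dormant
route whose cruxes are open; nothing here bears on VP ≠ VNP.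
-/

noncomputable section

open MvPolynomial

-- the summit and the problem share the name `ValiantsHypothesis` (D-0017 single-conjunct layout)
set_option linter.dupNamespace false

namespace Summit.ValiantsHypothesis.ValiantsHypothesis.Theorems.LangWeilTransfer

open Literature.NumberTheory.DiophantineGeometry (IsAbsIrreducible)
open Literature.Computability.AlgebraicComplexity (weight)
open Summit.ValiantsHypothesis.ValiantsHypothesis.Theses.LangWeilTransfer

/-- The size bookkeeping of `exists_small_prime_point` (pure arithmetic): with
`β = T + r + ΔQ + Δρ + LQ + Lρ + 2`, a prime `p ≤ 2^{2 log₂(X₀ + #bad' + 2) + 6}` where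
`X₀ ≤ 2^T + 6(ΔQ+1)^6(Δρ+1)^6` and `#bad' ≤ 124((r+1)(ΔQ+1)(LQ+1))^9 + LQ + Lρ` satisfies
`p ≤ 2^{β^8}`. -/
theorem small_prime_bound {T r ΔQ Δρ LQ Lρ X₀ cbad c₁ c₂ p : ℕ}
    (hX₀ : X₀ ≤ 2 ^ T + 6 * (ΔQ + 1) ^ 6 * (Δρ + 1) ^ 6)
    (hcbad : cbad ≤ 124 * ((r + 1) * (ΔQ + 1) * (LQ + 1)) ^ 9) (hc₁ : c₁ ≤ LQ) (hc₂ : c₂ ≤ Lρ)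
    (hple : p ≤ 2 ^ (2 * Nat.log 2 (X₀ + (cbad + c₁ + c₂) + 2) + 6)) :
    p ≤ 2 ^ ((T + r + ΔQ + Δρ + LQ + Lρ + 2) ^ 8) := by
  obtain ⟨β, hβ⟩ : ∃ β, β = T + r + ΔQ + Δρ + LQ + Lρ + 2 := ⟨_, rfl⟩
  rw [← hβ]
  have hβ2 : 2 ≤ β := by omega
  have hβ1 : 1 ≤ β := by omega
  have h2pow : ∀ n : ℕ, n ≤ 2 ^ n := fun n => (Nat.lt_two_pow_self).le
  -- `P ≤ β³`, `#bad' ≤ 126 β^27`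
  have hP : (r + 1) * (ΔQ + 1) * (LQ + 1) ≤ β ^ 3 := by
    calc (r + 1) * (ΔQ + 1) * (LQ + 1) ≤ β * β * β :=
          Nat.mul_le_mul (Nat.mul_le_mul (by omega) (by omega)) (by omega)
      _ = β ^ 3 := by ring
  have hβ27 : β ≤ β ^ 27 := by
    calc β = β ^ 1 := (pow_one β).symm
      _ ≤ β ^ 27 := Nat.pow_le_pow_right hβ1 (by norm_num)
  have h12 : β ^ 12 ≤ β ^ 27 := Nat.pow_le_pow_right hβ1 (by norm_num)
  have hbad' : cbad + c₁ + c₂ ≤ 126 * β ^ 27 := by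
    have h1 : cbad ≤ 124 * β ^ 27 := by
      calc cbad ≤ 124 * ((r + 1) * (ΔQ + 1) * (LQ + 1)) ^ 9 := hcbad
        _ ≤ 124 * (β ^ 3) ^ 9 := Nat.mul_le_mul_left _ (Nat.pow_le_pow_left hP 9)
        _ = 124 * β ^ 27 := by rw [← pow_mul]
    have h2 : c₁ + c₂ ≤ 2 * β ^ 27 := by omega
    omega
  -- `X₀ ≤ 2^β + 6 β^12`
  have hX₀' : X₀ ≤ 2 ^ β + 6 * β ^ 27 := by
    have h1 : (ΔQ + 1) ^ 6 * (Δρ + 1) ^ 6 ≤ β ^ 12 := by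
      calc (ΔQ + 1) ^ 6 * (Δρ + 1) ^ 6 ≤ β ^ 6 * β ^ 6 :=
            Nat.mul_le_mul (Nat.pow_le_pow_left (by omega) 6) (Nat.pow_le_pow_left (by omega) 6)
        _ = β ^ 12 := by rw [← pow_add]
    have h2 : 2 ^ T ≤ 2 ^ β := Nat.pow_le_pow_right two_pos (by omega)
    have h3 : 6 * (ΔQ + 1) ^ 6 * (Δρ + 1) ^ 6 ≤ 6 * β ^ 27 := by
      rw [mul_assoc]; exact Nat.mul_le_mul_left _ (h1.trans h12)
    omega
  -- total `≤ 2^(27 β + 9)`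
  have hpow27 : β ^ 27 ≤ 2 ^ (27 * β) := by
    calc β ^ 27 ≤ (2 ^ β) ^ 27 := Nat.pow_le_pow_left (h2pow β) 27
      _ = 2 ^ (27 * β) := by rw [← pow_mul, mul_comm]
  have htot : X₀ + (cbad + c₁ + c₂) + 2 ≤ 2 ^ (27 * β + 9) := by
    have h1 : X₀ + (cbad + c₁ + c₂) + 2 ≤ 2 ^ β + 134 * β ^ 27 := by
      have : 2 ≤ 2 * β ^ 27 := by
        have := Nat.one_le_pow 27 β hβ1; omega
      omega
    have h2 : 2 ^ β + 134 * β ^ 27 ≤ 2 ^ (27 * β + 9) := by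
      have e1 : (2 : ℕ) ^ β ≤ 2 ^ (27 * β + 8) := Nat.pow_le_pow_right two_pos (by omega)
      have e2 : 134 * β ^ 27 ≤ 2 ^ (27 * β + 8) := by
        calc 134 * β ^ 27 ≤ 2 ^ 8 * 2 ^ (27 * β) := Nat.mul_le_mul (by norm_num) hpow27
          _ = 2 ^ (27 * β + 8) := by rw [← pow_add, add_comm]
      have e3 : (2 : ℕ) ^ (27 * β + 9) = 2 ^ (27 * β + 8) + 2 ^ (27 * β + 8) := by
        rw [pow_succ]; ring
      omega
    exact h1.trans h2
  have hlog : Nat.log 2 (X₀ + (cbad + c₁ + c₂) + 2) ≤ 27 * β + 9 := by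
    have := Nat.log_mono_right (b := 2) htot
    rwa [Nat.log_pow one_lt_two] at this
  -- `μ ≤ 66 β ≤ β^8`
  have hμ : 2 * Nat.log 2 (X₀ + (cbad + c₁ + c₂) + 2) + 6 ≤ β ^ 8 := by
    have h1 : 2 * Nat.log 2 (X₀ + (cbad + c₁ + c₂) + 2) + 6 ≤ 66 * β := by omega
    have h2 : 66 ≤ β ^ 7 := le_trans (by norm_num) (Nat.pow_le_pow_left hβ2 7)
    calc _ ≤ 66 * β := h1
      _ ≤ β ^ 7 * β := Nat.mul_le_mul_right _ h2
      _ = β ^ 8 := by rw [← pow_succ]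
  exact hple.trans (Nat.pow_le_pow_right two_pos hμ)

/-- **A small prime with an `𝔽_p`-point on an absolutely irreducible integer hypersurface, off a
second hypersurface** (the unconditional core of Theorem T for one geometric component). For
`Q ∈ ℤ[X_0..X_r]` absolutely irreducible over `ℚ` with constant integer leading `X_0`-coefficient
`cQ ≠ 0` and positive `X_0`-degree, `ρ ∈ ℤ[X_1..X_r] ∖ 0`, and every `T`: there is a prime `p` with
`2^T < p ≤ 2^{β^8}`, `β = T + r + deg Q + deg ρ + log₂ wt Q + log₂ wt ρ + 2`, and `x ∈ 𝔽_p^{r+1}` with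
`Q(x) = 0` and `ρ(x_1, …, x_r) ≠ 0`. -/
theorem exists_small_prime_point (r T : ℕ) (Q : MvPolynomial (Fin (r + 1)) ℤ)
    (ρ : MvPolynomial (Fin r) ℤ) (cQ : ℤ)
    (hQ : IsAbsIrreducible (MvPolynomial.map (Int.castRingHom ℚ) Q)) (hcQ : cQ ≠ 0) (hρ : ρ ≠ 0)
    (hlc : (finSuccEquiv ℤ r Q).leadingCoeff = C cQ) (hdeg : 0 < (finSuccEquiv ℤ r Q).natDegree) :
    ∃ (p : ℕ) (_ : Fact p.Prime), 2 ^ T < p ∧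
      p ≤ 2 ^ ((T + r + Q.totalDegree + ρ.totalDegree + Nat.log 2 (weight Q) +
        Nat.log 2 (weight ρ) + 2) ^ 8) ∧
      ∃ x : Fin (r + 1) → GaloisField p 1,
        MvPolynomial.aeval x Q = 0 ∧ MvPolynomial.aeval (x ∘ Fin.succ) ρ ≠ 0 := by
  classical
  -- the good-reduction modulus and the two coefficients to avoid
  obtain ⟨N, hN0, hNlog, hgood⟩ := exists_good_reduction_modulus r Q hQ
  obtain ⟨n₀, hn₀⟩ := MvPolynomial.ne_zero_iff.mp hρ
  have hcQcoeff : cQ = coeff (Finsupp.cons (finSuccEquiv ℤ r Q).natDegree 0) Q := by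
    have := congr_arg (coeff (0 : Fin r →₀ ℕ)) hlc
    rwa [coeff_C, if_pos rfl, Polynomial.leadingCoeff, finSuccEquiv_coeff_coeff, eq_comm] at this
  -- the prime
  set X₀ := max (2 ^ T) (6 * (Q.totalDegree + 1) ^ 6 * (ρ.totalDegree + 1) ^ 6) with hX₀
  set bad' := N.natAbs.primeFactors ∪ cQ.natAbs.primeFactors ∪ (coeff n₀ ρ).natAbs.primeFactors
    with hbad'
  obtain ⟨p, hp, hpX, hpbad, hple⟩ := exists_prime_gt_notMem_le X₀ bad'
  haveI hpF : Fact p.Prime := ⟨hp⟩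
  have hpN : ¬ (p : ℤ) ∣ N := fun h =>
    hpbad (by rw [hbad']; simp [Nat.mem_primeFactors, hp, Int.natCast_dvd.mp h, hN0])
  have hpcQ : ¬ p ∣ cQ.natAbs := fun h =>
    hpbad (by rw [hbad']; simp [Nat.mem_primeFactors, hp, h, hcQ])
  have hpn₀ : ¬ p ∣ (coeff n₀ ρ).natAbs := fun h =>
    hpbad (by rw [hbad']; simp [Nat.mem_primeFactors, hp, h, hn₀])
  -- the field `𝔽_p = GaloisField p 1`, `Q mod p` absolutely irreducible, `ρ mod p ≠ 0`
  set K := GaloisField p 1 with hK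
  haveI : Fintype K := Fintype.ofFinite K
  have halg : algebraMap ℤ K = Int.castRingHom K := RingHom.ext_int _ _
  have hQ₁ := hgood p hpN
  rw [halg] at hQ₁
  set Q₁ := MvPolynomial.map (Int.castRingHom K) Q with hQ₁def
  have hcQF : (cQ : K) ≠ 0 := by
    rw [Ne, CharP.intCast_eq_zero_iff K p, Int.natCast_dvd]; exact hpcQ
  have hn₀F : ((coeff n₀ ρ : ℤ) : K) ≠ 0 := by
    rw [Ne, CharP.intCast_eq_zero_iff K p, Int.natCast_dvd]; exact hpn₀
  set ρ' : MvPolynomial (Fin (r + 1)) ℤ := rename Fin.succ ρ with hρ'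
  set G : MvPolynomial (Fin (r + 1)) K := MvPolynomial.map (Int.castRingHom K) ρ' with hG
  set g : MvPolynomial (Fin r) K := MvPolynomial.map (Int.castRingHom K) ρ with hg
  have hg0 : g ≠ 0 := by
    intro h0
    have := congr_arg (coeff n₀) h0
    rw [hg, coeff_map, coeff_zero, eq_intCast] at this
    exact hn₀F this
  have hGg : finSuccEquiv K r G = Polynomial.C g := by
    rw [hG, hρ', map_rename, ← hg, finSuccEquiv_rename_succ_eq_C]
  have hQ₁nu : ¬ IsUnit Q₁ := fun hu => hQ₁.not_isUnit (hu.map _)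
  have hndvd : ¬ Q₁ ∣ G := not_dvd_of_dvd_map hlc hcQF hQ₁nu (dvd_refl _) hg0 hGg
  -- degrees and the Lang–Weil threshold
  have hQ₁deg : Q₁.totalDegree ≤ Q.totalDegree := Finset.sup_mono (support_map_subset _ _)
  have hGdeg : G.totalDegree ≤ ρ.totalDegree :=
    (Finset.sup_mono (support_map_subset _ _)).trans (totalDegree_rename_le _ _)
  have hcardK : Fintype.card K = p := by
    rw [Fintype.card_eq_nat_card, hK, GaloisField.card p 1 one_ne_zero, pow_one]
  have hLWhyp : 6 * (Q₁.totalDegree + 1) ^ 6 * (G.totalDegree + 1) ^ 6 < Fintype.card K := by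
    calc 6 * (Q₁.totalDegree + 1) ^ 6 * (G.totalDegree + 1) ^ 6
        ≤ 6 * (Q.totalDegree + 1) ^ 6 * (ρ.totalDegree + 1) ^ 6 := by gcongr
      _ ≤ X₀ := le_max_right _ _
      _ < p := hpX
      _ = Fintype.card K := hcardK.symm
  obtain ⟨x, hxQ₁, hxG⟩ : ∃ x : Fin (r + 1) → K,
      MvPolynomial.aeval x Q₁ = 0 ∧ MvPolynomial.aeval x G ≠ 0 := by
    clear_value X₀ bad' Q₁ ρ' G g
    cases r with
    | zero => exact exists_point_fin_one Q₁ G hQ₁ hndvd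
    | succ k => exact exists_point_of_pos k Q₁ G hQ₁ hndvd hLWhyp
  -- read off the point
  have haeval : ∀ q : MvPolynomial (Fin (r + 1)) ℤ,
      aeval x q = eval x (MvPolynomial.map (Int.castRingHom K) q) := fun q => by
    rw [eval_map, aeval_def, halg]
  refine ⟨p, hpF, lt_of_le_of_lt (le_max_left _ _) hpX, ?_, x, ?_, ?_⟩
  · -- size
    have hc₁ : cQ.natAbs.primeFactors.card ≤ Nat.log 2 (weight Q) := by
      refine (Literature.NumberTheory.Sieve.BombieriSieve.card_primeFactors_le_log _).trans
        (Nat.log_mono_right ?_)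
      rw [hcQcoeff]
      exact Finset.single_le_sum (f := fun n => (coeff n Q).natAbs) (fun _ _ => Nat.zero_le _)
        (mem_support_iff.mpr (by rw [← hcQcoeff]; exact hcQ))
    have hc₂ : (coeff n₀ ρ).natAbs.primeFactors.card ≤ Nat.log 2 (weight ρ) := by
      refine (Literature.NumberTheory.Sieve.BombieriSieve.card_primeFactors_le_log _).trans
        (Nat.log_mono_right ?_)
      exact Finset.single_le_sum (f := fun n => (coeff n ρ).natAbs) (fun _ _ => Nat.zero_le _)
        (mem_support_iff.mpr hn₀)
    have hcN : N.natAbs.primeFactors.card ≤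
        124 * ((r + 1) * (Q.totalDegree + 1) * (Nat.log 2 (weight Q) + 1)) ^ 9 :=
      (Literature.NumberTheory.Sieve.BombieriSieve.card_primeFactors_le_log _).trans hNlog
    have hbad'card : bad'.card ≤ N.natAbs.primeFactors.card + cQ.natAbs.primeFactors.card +
        (coeff n₀ ρ).natAbs.primeFactors.card := by
      rw [hbad']
      exact (Finset.card_union_le _ _).trans (Nat.add_le_add_right (Finset.card_union_le _ _) _)
    have hX₀le : X₀ ≤ 2 ^ T + 6 * (Q.totalDegree + 1) ^ 6 * (ρ.totalDegree + 1) ^ 6 :=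
      max_le (Nat.le_add_right _ _) (Nat.le_add_left _ _)
    refine small_prime_bound hX₀le hcN hc₁ hc₂ (hple.trans (Nat.pow_le_pow_right two_pos ?_))
    have := Nat.log_mono_right (b := 2) (show X₀ + bad'.card + 2 ≤
      X₀ + (N.natAbs.primeFactors.card + cQ.natAbs.primeFactors.card +
        (coeff n₀ ρ).natAbs.primeFactors.card) + 2 by omega)
    omega
  · rw [haeval]; exact hxQ₁
  · intro h0
    apply hxG
    change eval x G = 0
    rw [hG, ← haeval, hρ', aeval_rename, h0]

end Summit.ValiantsHypothesis.ValiantsHypothesis.Theorems.LangWeilTransfer
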